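import Literature.RingTheory.KTheory.MilnorKWittRingSpringerTheorem
import HarnessLib

/-!
# LEMMA 2.6: for a henselian discretely valued field `E` with residue field `F̄` and `p ≠ char F̄`, the sequence
# `0 → K_nF̄/p → K_nE/p →∂ K_{n−1}F̄/p → 0` is split exact
# (Milnor, *Algebraic K-theory and quadratic forms*, Invent. Math. 9 (1970), §2)

Family `hodge`, lane `lit-hodgefound` (foundations library; seat `lit-hodgefound-p27`, generation 42, row g42-#5);
topic `RingTheory/KTheory`.  Sequel of `MilnorKTameSymbol` (g40-#1: for a valuation `v` and a prime element `π` the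
specialisation `psi v hπ n = ψ : K_nE →+ K_nF̄`, the tame symbol `boundary v hπ n = ∂ : K_{n+1}E →+ K_nF̄`,
`psi_symbol`, `boundary_symbol_cons_units`, `boundary_symbol_eq_zero_of_units`, `boundary_surjective`, the generators
`primeUnitSymbols` with `closure_primeUnitSymbols`, `cons_mul`, `res`), of `MilnorKGroups` (g39: `MilnorK`, `symbol`,
`lift`, `symbol_update_mul`, `symbol_update_zpow`, `symbol_eq_zero_of_add_eq_one`, `induction_on`) and of
`MilnorKWittRingSpringerTheorem` (g42-#4: the unit lifts `WittRing.unitLift`, `WittRing.exists_unit_coe_eq_add`, and the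
model for the hypothesis «units congruent to 1 have p-th roots»).  The `K`-theory twin of Springer's theorem.
DEFINITIONS WITH BODIES (`pMultiples`, `ModP`, `modPMap`, `modPLift`, `unitSymbols`, `sFun`, `sSlot`, `sMulti`, `sHom`,
`sModP`) and PROVED THEOREMS; no named fact, no instance, no notation, 0 `sorry`, net debt 0 (D-0026).

## The source, verbatim

J. Milnor, *Algebraic K-theory and quadratic forms*, Invent. Math. 9 (1970) 318–344 (held `paper:doi-10-1007-bf01425486`;
bib key `Milnor1970`), §2 (p0010 L17–L27): «To conclude this section, let us record a similar, but easier statement.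
**LEMMA 2.6.** Suppose that a field E is complete under a discrete valuation with residue class field Ē = F. Then for
any prime p distinct from the characteristic of F̄, there is a natural split exact sequence
0 → K_nF/pK_nF → K_nE/pK_nE →∂ K_{n−1}F/pK_{n−1}F → 0. *Proof.* If a unit of E maps to 1 in F, then it has a p-th
root. Hence the correspondence l(ū) → l(u) mod pK₁E is well defined. This correspondence extends to a ring
homomorphism K_*F → K_*E/pK_*E. Further details will be left to the reader.»  Used with §2 Lemma 2.1 (p0005
L36–L40: «∂ […] carries the product l(π)l(u₂)⋯l(uₙ) to l(ū₂)⋯l(ūₙ) […] annihilates every product of the form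
l(u₁)⋯l(uₙ)»), its uniqueness proof (p0006 L14–L16: «Since F• is generated by π and U, it follows that K_nF is generated
by products of the form l(π)^r l(u_{r+1})⋯l(uₙ)») and Lemma 2.2 (p0007 L46–L49: «ψ is defined by the rule
l(π^{i₁}u₁)⋯l(π^{iₙ}uₙ) ↦ l(ū₁)⋯l(ūₙ)»).

## What is formalised («Further details will be left to the reader» — here they are; `F̄ = ValResidueField v`)

* §0 `pMultiples A p = p·A`, **`ModP A p = A/pA`** for an abelian group `A` and any `p : ℕ`, `modPMap` (functoriality).
* §1 the hypothesis **(Hₚ) «a unit of E which maps to 1 in F̄ has a p-th root»** (`∀ u, v(u) = 0 → ū = 1 → ∃ z,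
  u = z ^ p`; §5 derives it from `HenselianLocalRing` + `(p : F̄) ≠ 0` by Hensel's lemma for `X^p − u`,
  `exists_eq_pow_of_res_eq_one`) and **«l(ū) → l(u) mod pK₁E is well defined»** in all degrees: unit tuples with the
  same residues have congruent symbols modulo `p` (`symbol_sub_symbol_mem_of_res_eq`).
* §2 **the homomorphism `s : K_nF̄ → K_nE/p`, `{ū₁, …, ūₙ} ↦ [{u₁, …, uₙ}]`** (`sHom`, through `MilnorK.lift`: multilinear
  by (Hₚ), Steinberg because `ū + ū′ = 1` lifts to `u + (1 − u) = 1`), its value on ANY unit lifts (`sHom_symbol_res`),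
  and its factorisation **`sModP : K_nF̄/p →+ K_nE/p`**.
* §3 **`ψ ∘ s = id`** (`psiModP_sModP`), **`∂ ∘ s = 0`** (`boundaryModP_sModP`), `sModP_injective`; the unit symbols
  `unitSymbols` with **`s(ψ a) = [a]`** for `a` in their span (`sHom_psi_eq_mk`), the decomposition of `K_{n+1}E` as
  «unit symbols + l(π)·unit symbols» (`exists_mem_unitSymbols_add_cons`, from `closure_primeUnitSymbols` and
  `l(πu₁) = l(π) + l(u₁)`), `∂(l(π)·b) = ψ(b)` on unit symbols (`boundary_cons_eq_psi`).
* §4 **LEMMA 2.6**: exactness in the middle **`boundaryModP_eq_zero_iff`** (`∂[x] = 0 ↔ [x] ∈ im s`), `∂` onto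
  (`boundaryModP_surjective`), and the split packaging **`bijective_psiModP_prod_boundaryModP`**:
  `[x] ↦ (ψ[x], ∂[x])` is a bijection `K_{n+1}E/p → K_{n+1}F̄/p × K_nF̄/p` (for all `n ≥ 0`, i.e. Milnor's `n ≥ 1`).
* §5 (Hₚ) for henselian valuation rings (`exists_eq_pow_of_res_eq_one`) and the theorem in that form
  (`bijective_psiModP_prod_boundaryModP_of_henselian`).
* Not here: the ring structure («extends to a ring homomorphism K_*F → K_*E/pK_*E»: multiplicativity of `s` for the
  graded product is not needed for the exact sequence and is left out); Corollary 5.2.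

## References

* [Milnor1970] J. Milnor, *Algebraic K-theory and quadratic forms*, Invent. Math. 9 (1970) 318–344 — §2 Lemma 2.6 and
  its proof sketch (p0010 L17–L27); Lemma 2.1 (p0005 L36–L40), proof of uniqueness (p0006 L14–L18), Lemma 2.2 (p0007
  L39–L51).
* [Springer1955] T.A. Springer, *Quadratic forms over fields with a discrete valuation. I*, Indag. Math. 17 (1955)
  352–362 — the Witt-ring model of the argument (tree: `MilnorKWittRingSpringerTheorem`).

Provenance: lane `lit-hodgefound`, seat `lit-hodgefound-p27` gen 42 (agent `literature-prover-lit-hodgefound-p27-g42-0`),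
row g42-#5.
-/

set_option autoImplicit false

noncomputable section

namespace Literature.RingTheory.KTheory

open Function

/-! ### §0 `A/pA` -/

section ModP

variable (A : Type*) [AddCommGroup A] (p : ℕ)

/-- **`pA ⊂ A`**: the `p`-multiples («K_nF/pK_nF»). [cite: Milnor1970, §2 Lemma 2.6 (p0010 L18–L21)] -/
def pMultiples : AddSubgroup A := (zsmulAddGroupHom (α := A) (p : ℤ)).range

/-- Membership in `pA`. [cite: Milnor1970, §2 Lemma 2.6 (p0010 L18–L21)] -/
theorem mem_pMultiples_iff {x : A} : x ∈ pMultiples A p ↔ ∃ y : A, (p : ℤ) • y = x := by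
  simp only [pMultiples, AddMonoidHom.mem_range, zsmulAddGroupHom_apply]

/-- `p·y ∈ pA`. [cite: Milnor1970, §2 Lemma 2.6 (p0010 L18–L21)] -/
theorem zsmul_mem_pMultiples (y : A) : (p : ℤ) • y ∈ pMultiples A p := (mem_pMultiples_iff A p).2 ⟨y, rfl⟩

/-- **`A/pA`** («K_nE/pK_nE»). [cite: Milnor1970, §2 Lemma 2.6 (p0010 L18–L21)] -/
abbrev ModP : Type _ := A ⧸ pMultiples A p

/-- `[p·y] = 0` in `A/pA`. [cite: Milnor1970, §2 Lemma 2.6 (p0010 L18–L21)] -/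
theorem mk_zsmul_eq_zero (y : A) : (((p : ℤ) • y : A) : ModP A p) = 0 :=
  (QuotientAddGroup.eq_zero_iff _).2 (zsmul_mem_pMultiples A p y)

/-- `A/pA` is killed by `p`. [cite: Milnor1970, §2 Lemma 2.6 (p0010 L18–L21)] -/
theorem zsmul_eq_zero_modP (ξ : ModP A p) : (p : ℤ) • ξ = 0 := by
  induction ξ using QuotientAddGroup.induction_on with
  | H y => rw [← QuotientAddGroup.mk_zsmul, mk_zsmul_eq_zero]

variable {A} {B : Type*} [AddCommGroup B]

/-- Functoriality of `A ↦ A/pA`. [cite: Milnor1970, §2 Lemma 2.6 (p0010 L18–L21)] -/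
def modPMap (f : A →+ B) : ModP A p →+ ModP B p :=
  QuotientAddGroup.map (pMultiples A p) (pMultiples B p) f (by
    rintro x ⟨y, rfl⟩
    exact ⟨f y, by rw [zsmulAddGroupHom_apply, zsmulAddGroupHom_apply, map_zsmul]⟩)

/-- `modPMap f [x] = [f x]`. [cite: Milnor1970, §2 Lemma 2.6 (p0010 L18–L21)] -/
theorem modPMap_mk (f : A →+ B) (x : A) : modPMap p f (x : ModP A p) = ((f x : B) : ModP B p) := rfl

/-- A homomorphism into a group killed by `p` factors through `A/pA`. [cite: Milnor1970, §2 Lemma 2.6 (p0010 L18–L21)] -/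
def modPLift (f : A →+ ModP B p) : ModP A p →+ ModP B p :=
  QuotientAddGroup.lift (pMultiples A p) f (by
    rintro x ⟨y, rfl⟩
    rw [AddMonoidHom.mem_ker, zsmulAddGroupHom_apply, map_zsmul, zsmul_eq_zero_modP])

/-- `modPLift f [x] = f x`. [cite: Milnor1970, §2 Lemma 2.6 (p0010 L18–L21)] -/
theorem modPLift_mk (f : A →+ ModP B p) (x : A) : modPLift p f (x : ModP A p) = f x := rfl

end ModP

namespace MilnorK

section Lemma26

variable {E : Type*} [Field E] (v : Valuation E (WithZero (Multiplicative ℤ))) {π : Eˣ} (hπ : addVal v π = 1) (p : ℕ)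

/-! ### §1 (Hₚ): units congruent to `1` are `p`-th powers; «l(ū) → l(u) mod pK₁E is well defined» -/

/-- Under (Hₚ), two units with the same residue differ by a `p`-th power. [cite: Milnor1970, §2 proof of Lemma 2.6 «If a unit of E maps to 1 in F, then it has a p-th root. Hence the correspondence l(ū) → l(u) mod pK₁E is well defined» (p0010 L22–L24)] -/
theorem exists_eq_mul_pow_of_res_eq (hpow : ∀ u : Eˣ, addVal v u = 0 → res v hπ u = 1 → ∃ z : Eˣ, u = z ^ p)
    {u u' : Eˣ} (hu : addVal v u = 0) (hu' : addVal v u' = 0) (h : res v hπ u = res v hπ u') :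
    ∃ z : Eˣ, u = u' * z ^ p := by
  have hw : addVal v (u * u'⁻¹) = 0 := by rw [addVal_mul, addVal_inv, hu, hu', neg_zero, add_zero]
  have hw1 : res v hπ (u * u'⁻¹) = 1 := by rw [map_mul, map_inv, h, mul_inv_cancel]
  obtain ⟨z, hz⟩ := hpow _ hw hw1
  exact ⟨z, by rw [← hz, mul_comm u, ← _root_.mul_assoc, mul_inv_cancel, _root_.one_mul]⟩

/-- Changing one entry by a `p`-th power changes the symbol by a `p`-multiple. [cite: Milnor1970, §2 proof of Lemma 2.6 (p0010 L22–L24); §1 multilinearity (p0002 L19–L21)] -/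
theorem symbol_update_mul_pow_sub_mem {n : ℕ} (a : Fin n → Eˣ) (i : Fin n) (x z : Eˣ) :
    symbol (update a i (x * z ^ p)) - symbol (update a i x) ∈ pMultiples (MilnorK E n) p := by
  rw [symbol_update_mul, add_sub_cancel_left, ← zpow_natCast, symbol_update_zpow]
  exact zsmul_mem_pMultiples _ _ _

/-- **«l(ū) → l(u) mod pK₁E is well defined», in all degrees**: two tuples of units with the same residues have
congruent symbols modulo `p` (slot by slot, by multilinearity). [cite: Milnor1970, §2 proof of Lemma 2.6 (p0010 L22–L25)] -/
theorem symbol_sub_symbol_mem_of_res_eq (hpow : ∀ u : Eˣ, addVal v u = 0 → res v hπ u = 1 → ∃ z : Eˣ, u = z ^ p)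
    {n : ℕ} (a b : Fin n → Eˣ) (ha : ∀ j, addVal v (a j) = 0) (hb : ∀ j, addVal v (b j) = 0)
    (h : ∀ j, res v hπ (a j) = res v hπ (b j)) : symbol a - symbol b ∈ pMultiples (MilnorK E n) p := by
  classical
  -- `c k` agrees with `b` on the slots `< k` and with `a` afterwards
  suffices H : ∀ k : ℕ, symbol a - symbol (fun j : Fin n => if (j : ℕ) < k then b j else a j) ∈
      pMultiples (MilnorK E n) p by
    have hn := H n
    have e : (fun j : Fin n => if (j : ℕ) < n then b j else a j) = b := funext fun j => if_pos j.isLt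
    rwa [e] at hn
  intro k
  induction k with
  | zero =>
    have e : (fun j : Fin n => if (j : ℕ) < 0 then b j else a j) = a := funext fun j => if_neg (Nat.not_lt_zero _)
    rw [e, sub_self]
    exact zero_mem _
  | succ k ih =>
    by_cases hk : k < n
    · set i : Fin n := ⟨k, hk⟩ with hi
      obtain ⟨z, hz⟩ := exists_eq_mul_pow_of_res_eq v hπ p hpow (ha i) (hb i) (h i)
      set c : Fin n → Eˣ := fun j => if (j : ℕ) < k + 1 then b j else a j with hc
      have hci : c i = b i := if_pos (Nat.lt_succ_self k)
      have e1 : (fun j : Fin n => if (j : ℕ) < k then b j else a j) = update c i (b i * z ^ p) := by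
        funext j
        by_cases hji : j = i
        · subst hji
          rw [update_self, ← hz, if_neg (lt_irrefl k)]
        · have hjk : (j : ℕ) ≠ k := fun e => hji (Fin.ext e)
          rw [update_of_ne hji, hc]
          by_cases hj : (j : ℕ) < k
          · simp only [hj, if_true, if_pos (Nat.lt_succ_of_lt hj)]
          · have hj' : ¬ (j : ℕ) < k + 1 := by omega
            simp only [hj, hj', if_false]
      have e2 : update c i (b i) = c := by rw [← hci, update_eq_self]
      have step := symbol_update_mul_pow_sub_mem p c i (b i) z
      rw [← e1, e2] at step
      have := add_mem ih step
      rwa [sub_add_sub_cancel] at this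
    · have e : (fun j : Fin n => if (j : ℕ) < k + 1 then b j else a j) =
          fun j : Fin n => if (j : ℕ) < k then b j else a j := by
        funext j
        have hj : (j : ℕ) < n := j.isLt
        rw [if_pos (by omega), if_pos (by omega)]
      rw [e]
      exact ih

/-! ### §2 The section `s : K_nF̄ → K_nE/p`, `{ū₁, …, ūₙ} ↦ [{u₁, …, uₙ}]` -/

/-- The chosen lifts of a tuple of residues. [cite: Milnor1970, §2 proof of Lemma 2.6 «l(ū) → l(u)» (p0010 L22–L24)] -/
theorem addVal_unitLift_comp {n : ℕ} (m : Fin n → Additive (ValResidueField v)ˣ) (j : Fin n) :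
    addVal v (WittRing.unitLift v hπ (Additive.toMul (m j))) = 0 :=
  WittRing.addVal_unitLift v hπ _

/-- **The correspondence on tuples**: `(ū₁, …, ūₙ) ↦ [{u₁, …, uₙ}] ∈ K_nE/p` with the chosen lifts. [cite: Milnor1970, §2 proof of Lemma 2.6 (p0010 L22–L25)] -/
def sFun (n : ℕ) (m : Fin n → Additive (ValResidueField v)ˣ) : ModP (MilnorK E n) p :=
  ((symbol fun j => WittRing.unitLift v hπ (Additive.toMul (m j)) : MilnorK E n) : ModP (MilnorK E n) p)

/-- **The correspondence takes the value `[{u₁, …, uₙ}]` on ANY unit lifts** (well-definedness). [cite: Milnor1970, §2 proof of Lemma 2.6 «the correspondence l(ū) → l(u) mod pK₁E is well defined» (p0010 L22–L24)] -/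
theorem sFun_eq_mk_symbol (hpow : ∀ u : Eˣ, addVal v u = 0 → res v hπ u = 1 → ∃ z : Eˣ, u = z ^ p) {n : ℕ}
    (m : Fin n → Additive (ValResidueField v)ˣ) (u : Fin n → Eˣ) (hu : ∀ j, addVal v (u j) = 0)
    (hres : ∀ j, res v hπ (u j) = Additive.toMul (m j)) :
    sFun v hπ p n m = ((symbol u : MilnorK E n) : ModP (MilnorK E n) p) := by
  rw [sFun, QuotientAddGroup.eq_iff_sub_mem]
  exact symbol_sub_symbol_mem_of_res_eq v hπ p hpow _ _ (addVal_unitLift_comp v hπ m) hu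
    fun j => by rw [WittRing.res_unitLift, hres]

variable (hpow : ∀ u : Eˣ, addVal v u = 0 → res v hπ u = 1 → ∃ z : Eˣ, u = z ^ p)

include hpow

/-- **Multilinearity** («extends»): additivity in each slot, `ūū′` lifting to `uu′`. [cite: Milnor1970, §2 proof of Lemma 2.6 (p0010 L24–L25); §1 (p0002 L19–L21)] -/
theorem sFun_update_add {n : ℕ} (m : Fin n → Additive (ValResidueField v)ˣ) (i : Fin n)
    (x y : Additive (ValResidueField v)ˣ) :
    sFun v hπ p n (update m i (x + y)) = sFun v hπ p n (update m i x) + sFun v hπ p n (update m i y) := by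
  set L : Additive (ValResidueField v)ˣ → Eˣ := fun r => WittRing.unitLift v hπ (Additive.toMul r) with hL
  have hLval : ∀ r, addVal v (L r) = 0 := fun r => WittRing.addVal_unitLift v hπ _
  have hLres : ∀ r, res v hπ (L r) = Additive.toMul r := fun r => WittRing.res_unitLift v hπ _
  -- unit lifts of the three updated tuples, differing only at slot `i`
  set U : Fin n → Eˣ := fun j => L (m j) with hU
  have hval : ∀ (w : Eˣ), addVal v w = 0 → ∀ j, addVal v (update U i w j) = 0 := by
    intro w hw j
    by_cases hji : j = i
    · subst hji; rw [update_self]; exact hw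
    · rw [update_of_ne hji]; exact hLval _
  have hres : ∀ (w : Eˣ) (r : Additive (ValResidueField v)ˣ), res v hπ w = Additive.toMul r →
      ∀ j, res v hπ (update U i w j) = Additive.toMul (update m i r j) := by
    intro w r hw j
    by_cases hji : j = i
    · subst hji; rw [update_self, update_self]; exact hw
    · rw [update_of_ne hji, update_of_ne hji]; exact hLres _
  have hxy : res v hπ (L x * L y) = Additive.toMul (x + y) := by rw [map_mul, hLres, hLres, toMul_add]
  rw [sFun_eq_mk_symbol v hπ p hpow _ (update U i (L x * L y))
      (hval _ (by rw [addVal_mul, hLval, hLval, add_zero])) (hres _ _ hxy),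
    sFun_eq_mk_symbol v hπ p hpow _ (update U i (L x)) (hval _ (hLval x)) (hres _ _ (hLres x)),
    sFun_eq_mk_symbol v hπ p hpow _ (update U i (L y)) (hval _ (hLval y)) (hres _ _ (hLres y)),
    symbol_update_mul, QuotientAddGroup.mk_add]

/-- The correspondence in one slot, as an additive homomorphism. [cite: Milnor1970, §2 proof of Lemma 2.6 (p0010 L24–L25)] -/
def sSlot {n : ℕ} (m : Fin n → Additive (ValResidueField v)ˣ) (i : Fin n) :
    Additive (ValResidueField v)ˣ →+ ModP (MilnorK E n) p :=
  AddMonoidHom.mk' (fun z => sFun v hπ p n (update m i z)) fun x y => sFun_update_add v hπ p hpow m i x y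

/-- Unfolding `sSlot`. [cite: Milnor1970, §2 proof of Lemma 2.6 (p0010 L24–L25)] -/
theorem sSlot_apply {n : ℕ} (m : Fin n → Additive (ValResidueField v)ˣ) (i : Fin n)
    (z : Additive (ValResidueField v)ˣ) : sSlot v hπ p hpow m i z = sFun v hπ p n (update m i z) := rfl

/-- `ℤ`-linearity in one slot. [cite: Milnor1970, §2 proof of Lemma 2.6 (p0010 L24–L25)] -/
theorem sFun_update_zsmul {n : ℕ} (m : Fin n → Additive (ValResidueField v)ˣ) (i : Fin n) (c : ℤ)
    (x : Additive (ValResidueField v)ˣ) :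
    sFun v hπ p n (update m i (c • x)) = c • sFun v hπ p n (update m i x) := by
  rw [← sSlot_apply v hπ p hpow, ← sSlot_apply v hπ p hpow, map_zsmul]

/-- The correspondence as an `n`-linear map. [cite: Milnor1970, §2 proof of Lemma 2.6 «extends» (p0010 L24–L25)] -/
def sMulti (n : ℕ) : MultilinearMap ℤ (fun _ : Fin n => Additive (ValResidueField v)ˣ) (ModP (MilnorK E n) p) where
  toFun := sFun v hπ p n
  map_update_add' m i x y := by convert sFun_update_add v hπ p hpow m i x y
  map_update_smul' m i c x := by convert sFun_update_zsmul v hπ p hpow m i c x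

/-- Unfolding `sMulti`. [cite: Milnor1970, §2 proof of Lemma 2.6 (p0010 L22–L25)] -/
theorem sMulti_apply {n : ℕ} (m : Fin n → Additive (ValResidueField v)ˣ) : sMulti v hπ p hpow n m = sFun v hπ p n m := rfl

/-- **The Steinberg relation**: if `ūᵢ + ūᵢ₊₁ = 1` then, lifting `ūᵢ₊₁` as `1 − uᵢ`, the symbol vanishes.
[cite: Milnor1970, §2 proof of Lemma 2.6 «extends to a ring homomorphism» (p0010 L24–L25); §1 the relation l(a)l(1 − a) = 0 (p0002 L19–L21)] -/
theorem sFun_eq_zero_of_add_eq_one {n : ℕ} (a : Fin n → (ValResidueField v)ˣ) (i : Fin n) (h : i.val + 1 < n)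
    (hsum : (a i : ValResidueField v) + a (finSucc i h) = 1) :
    sFun v hπ p n (fun j => Additive.ofMul (a j)) = 0 := by
  set u : Eˣ := WittRing.unitLift v hπ (a i) with hu
  have hu0 : addVal v u = 0 := WittRing.addVal_unitLift v hπ _
  have hures : res v hπ u = a i := WittRing.res_unitLift v hπ _
  -- `1 − u` is a unit with residue `1 − ūᵢ = ūᵢ₊₁`
  have hne : ((res v hπ 1 : (ValResidueField v)ˣ) : ValResidueField v) + (res v hπ (-u) : (ValResidueField v)ˣ) ≠ 0 := by
    rw [map_one, res_neg, hures, Units.val_one, Units.val_neg, ← sub_eq_add_neg, ← eq_sub_of_add_eq' hsum]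
    exact (a (finSucc i h)).ne_zero
  obtain ⟨z, hz0, hzE, hzres⟩ := WittRing.exists_unit_coe_eq_add v hπ (addVal_one v) (by rw [addVal_neg, hu0]) hne
  have hzres' : res v hπ z = a (finSucc i h) := Units.ext (by
    rw [hzres, map_one, res_neg, hures, Units.val_one, Units.val_neg, ← sub_eq_add_neg]
    exact (eq_sub_of_add_eq' hsum).symm)
  -- the unit tuple `U = (…, u, 1 − u, …)`
  set U : Fin n → Eˣ := update (fun j => WittRing.unitLift v hπ (a j)) (finSucc i h) z with hU
  have hUval : ∀ j, addVal v (U j) = 0 := by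
    intro j
    by_cases hj : j = finSucc i h
    · subst hj; rw [hU, update_self]; exact hz0
    · rw [hU, update_of_ne hj]; exact WittRing.addVal_unitLift v hπ _
  have hUres : ∀ j, res v hπ (U j) = Additive.toMul ((fun j => Additive.ofMul (a j)) j) := by
    intro j
    by_cases hj : j = finSucc i h
    · subst hj; rw [hU, update_self, toMul_ofMul]; exact hzres'
    · rw [hU, update_of_ne hj, toMul_ofMul]; exact WittRing.res_unitLift v hπ _
  rw [sFun_eq_mk_symbol v hπ p hpow _ U hUval hUres]
  have hUi : U i = u := by rw [hU, update_of_ne (finSucc_ne i h).symm]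
  have hUsucc : U (finSucc i h) = z := by rw [hU, update_self]
  rw [symbol_eq_zero_of_add_eq_one U i h (by rw [hUi, hUsucc, hzE, Units.val_one, Units.val_neg, _root_.add_comm ((u : Eˣ) : E), neg_add_cancel_right]),
    QuotientAddGroup.mk_zero]

/-- **The homomorphism `s : K_nF̄ → K_nE/p`, `{ū₁, …, ūₙ} ↦ [{u₁, …, uₙ}]`.** [cite: Milnor1970, §2 proof of Lemma 2.6 «This correspondence extends to a […] homomorphism K_*F → K_*E/pK_*E» (p0010 L24–L25)] -/
def sHom (n : ℕ) : MilnorK (ValResidueField v) n →+ ModP (MilnorK E n) p :=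
  lift (sMulti v hπ p hpow n) fun a i h hsum => by
    rw [sMulti_apply]
    exact sFun_eq_zero_of_add_eq_one v hπ p hpow a i h hsum

/-- **`s{ū₁, …, ūₙ} = [{u₁, …, uₙ}]` for ANY units `uⱼ`.** [cite: Milnor1970, §2 proof of Lemma 2.6 (p0010 L22–L25)] -/
theorem sHom_symbol_res {n : ℕ} (u : Fin n → Eˣ) (hu : ∀ j, addVal v (u j) = 0) :
    sHom v hπ p hpow n (symbol fun j => res v hπ (u j)) = ((symbol u : MilnorK E n) : ModP (MilnorK E n) p) := by
  rw [sHom, lift_symbol, sMulti_apply]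
  exact sFun_eq_mk_symbol v hπ p hpow _ u hu fun j => by rw [toMul_ofMul]

/-- **`s : K_nF̄/p → K_nE/p`** (the target is killed by `p`). [cite: Milnor1970, §2 Lemma 2.6 «K_nF/pK_nF → K_nE/pK_nE» (p0010 L18–L21)] -/
def sModP (n : ℕ) : ModP (MilnorK (ValResidueField v) n) p →+ ModP (MilnorK E n) p :=
  modPLift p (sHom v hπ p hpow n)

/-- `sModP [x] = sHom x`. [cite: Milnor1970, §2 Lemma 2.6 (p0010 L18–L21)] -/
theorem sModP_mk {n : ℕ} (x : MilnorK (ValResidueField v) n) :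
    sModP v hπ p hpow n (x : ModP (MilnorK (ValResidueField v) n) p) = sHom v hπ p hpow n x := rfl

/-! ### §3 `ψ ∘ s = id`, `∂ ∘ s = 0`, and the unit symbols -/

omit hpow in
/-- The residue of a tuple of units. [cite: Milnor1970, §2 Lemma 2.2 «l(π^{i₁}u₁)⋯l(π^{iₙ}uₙ) ↦ l(ū₁)⋯l(ūₙ)» (p0007 L46–L49)] -/
theorem psi_symbol_units {n : ℕ} (u : Fin n → Eˣ) :
    psi v hπ n (symbol u) = symbol fun j => res v hπ (u j) :=
  psi_symbol v hπ n u

/-- **`ψ ∘ s = id`** on `K_nF̄` («ψ carries l(πⁱu) to l(ū)»; the splitting). [cite: Milnor1970, §2 Lemma 2.6 «split exact» (p0010 L18–L21); Lemma 2.2 (p0007 L46–L49)] -/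
theorem psiModP_sHom {n : ℕ} (x : MilnorK (ValResidueField v) n) :
    modPMap p (psi v hπ n) (sHom v hπ p hpow n x) = (x : ModP (MilnorK (ValResidueField v) n) p) := by
  have h : (modPMap p (psi v hπ n)).comp (sHom v hπ p hpow n) =
      QuotientAddGroup.mk' (pMultiples (MilnorK (ValResidueField v) n) p) := hom_ext fun c => by
    choose u hu0 hures using fun j => WittRing.exists_unit_res_eq v hπ (c j)
    have hc : c = fun j => res v hπ (u j) := funext fun j => (hures j).symm
    rw [AddMonoidHom.comp_apply, QuotientAddGroup.mk'_apply, hc, sHom_symbol_res v hπ p hpow u hu0, modPMap_mk,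
      psi_symbol_units]
  exact DFunLike.congr_fun h x

/-- **`ψ ∘ s = id` on `K_nF̄/p`.** [cite: Milnor1970, §2 Lemma 2.6 «split exact» (p0010 L18–L21)] -/
theorem psiModP_sModP {n : ℕ} (ξ : ModP (MilnorK (ValResidueField v) n) p) :
    modPMap p (psi v hπ n) (sModP v hπ p hpow n ξ) = ξ := by
  induction ξ using QuotientAddGroup.induction_on with
  | H x => exact psiModP_sHom v hπ p hpow x

/-- **`s` is injective** (exactness at `K_nF̄/p`). [cite: Milnor1970, §2 Lemma 2.6 «0 → K_nF/pK_nF → K_nE/pK_nE» (p0010 L18–L21)] -/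
theorem sModP_injective {n : ℕ} : Function.Injective (sModP v hπ p hpow n) :=
  Function.LeftInverse.injective (psiModP_sModP v hπ p hpow)

/-- **`∂ ∘ s = 0`** («∂ annihilates every product of the form l(u₁)⋯l(uₙ)»). [cite: Milnor1970, §2 Lemma 2.1 (p0005 L38–L39); Lemma 2.6 (p0010 L18–L21)] -/
theorem boundaryModP_sHom {n : ℕ} (x : MilnorK (ValResidueField v) (n + 1)) :
    modPMap p (boundary v hπ n) (sHom v hπ p hpow (n + 1) x) = 0 := by
  have h : (modPMap p (boundary v hπ n)).comp (sHom v hπ p hpow (n + 1)) = 0 := hom_ext fun c => by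
    choose u hu0 hures using fun j => WittRing.exists_unit_res_eq v hπ (c j)
    have hc : c = fun j => res v hπ (u j) := funext fun j => (hures j).symm
    rw [AddMonoidHom.comp_apply, AddMonoidHom.zero_apply, hc, sHom_symbol_res v hπ p hpow u hu0, modPMap_mk,
      boundary_symbol_eq_zero_of_units v hπ n u hu0, QuotientAddGroup.mk_zero]
  exact DFunLike.congr_fun h x

/-- `∂ ∘ s = 0` on `K_{n+1}F̄/p`. [cite: Milnor1970, §2 Lemma 2.6 (p0010 L18–L21)] -/
theorem boundaryModP_sModP {n : ℕ} (ξ : ModP (MilnorK (ValResidueField v) (n + 1)) p) :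
    modPMap p (boundary v hπ n) (sModP v hπ p hpow (n + 1) ξ) = 0 := by
  induction ξ using QuotientAddGroup.induction_on with
  | H x => exact boundaryModP_sHom v hπ p hpow x

omit hpow in
/-- **The unit symbols `{u₁, …, uₙ}`** (the `r = 0` products «l(u₁)⋯l(uₙ)» of the uniqueness proof; their span is
Springer's `W₀`-analogue). [cite: Milnor1970, §2 proof of Lemma 2.1, uniqueness «products of the form l(π)^r l(u_{r+1})⋯l(uₙ) […] if r = 0» (p0006 L14–L18)] -/
def unitSymbols (n : ℕ) : Set (MilnorK E n) :=
  {z | ∃ u : Fin n → Eˣ, (∀ j, addVal v (u j) = 0) ∧ z = symbol u}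

/-- **`s(ψ a) = [a]` for `a` in the span of the unit symbols** (the two lifts of `ā` differ by `p`-th powers).
[cite: Milnor1970, §2 proof of Lemma 2.6 (p0010 L22–L25)] -/
theorem sHom_psi_eq_mk {n : ℕ} {a : MilnorK E n} (ha : a ∈ AddSubgroup.closure (unitSymbols v n)) :
    sHom v hπ p hpow n (psi v hπ n a) = (a : ModP (MilnorK E n) p) := by
  induction ha using AddSubgroup.closure_induction with
  | mem z hz =>
    obtain ⟨u, hu, rfl⟩ := hz
    rw [psi_symbol_units, sHom_symbol_res v hπ p hpow u hu]
  | zero => rw [map_zero, map_zero, QuotientAddGroup.mk_zero]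
  | add x y _ _ hx hy => rw [map_add, map_add, hx, hy, QuotientAddGroup.mk_add]
  | neg x _ hx => rw [map_neg, map_neg, hx, QuotientAddGroup.mk_neg]

omit hpow in
/-- **`∂(l(π)·b) = ψ(b)` for `b` in the span of the unit symbols** («carries l(π)l(u₂)⋯l(uₙ) to l(ū₂)⋯l(ūₙ)»).
[cite: Milnor1970, §2 Lemma 2.1 (p0005 L36–L38); Lemma 2.2 (p0007 L46–L49)] -/
theorem boundary_cons_eq_psi {n : ℕ} {b : MilnorK E n} (hb : b ∈ AddSubgroup.closure (unitSymbols v n)) :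
    boundary v hπ n (cons π b) = psi v hπ n b := by
  induction hb using AddSubgroup.closure_induction with
  | mem z hz =>
    obtain ⟨u, hu, rfl⟩ := hz
    rw [cons_symbol, boundary_symbol_cons_units v hπ n hπ u hu, psi_symbol_units]
    congr 1
    funext j
    rw [res_of_addVal_eq_zero v hπ (hu j)]
  | zero => rw [map_zero, map_zero, map_zero]
  | add x y _ _ hx hy => rw [map_add, map_add, map_add, hx, hy]
  | neg x _ hx => rw [map_neg, map_neg, map_neg, hx]

omit hpow in
/-- `∂ a = 0` for `a` in the span of the unit symbols. [cite: Milnor1970, §2 Lemma 2.1 «annihilates every product of the form l(u₁)⋯l(uₙ)» (p0005 L38–L39)] -/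
theorem boundary_eq_zero_of_mem_closure_unitSymbols {n : ℕ} {a : MilnorK E (n + 1)}
    (ha : a ∈ AddSubgroup.closure (unitSymbols v (n + 1))) : boundary v hπ n a = 0 := by
  induction ha using AddSubgroup.closure_induction with
  | mem z hz =>
    obtain ⟨u, hu, rfl⟩ := hz
    exact boundary_symbol_eq_zero_of_units v hπ n u hu
  | zero => exact map_zero _
  | add x y _ _ hx hy => rw [map_add, hx, hy, add_zero]
  | neg x _ hx => rw [map_neg, hx, neg_zero]

omit hpow in
include hπ in
/-- **`K_{n+1}E = (unit symbols) + l(π)·(unit symbols)`**: every element is `a + l(π)·b` with `a`, `b` in the spans of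
the unit symbols («Since F• is generated by π and U […] K_nF is generated by products of the form
l(π)^r l(u_{r+1})⋯l(uₙ)»; `{π′, u₂, …} = {π, u₂, …} + {π′/π, u₂, …}`). [cite: Milnor1970, §2 proof of Lemma 2.1, uniqueness (p0006 L14–L18)] -/
theorem exists_mem_unitSymbols_add_cons {n : ℕ} (x : MilnorK E (n + 1)) :
    ∃ a ∈ AddSubgroup.closure (unitSymbols v (n + 1)), ∃ b ∈ AddSubgroup.closure (unitSymbols v n),
      x = a + cons π b := by
  have hx : x ∈ AddSubgroup.closure (primeUnitSymbols v n) := by rw [closure_primeUnitSymbols v hπ]; trivial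
  induction hx using AddSubgroup.closure_induction with
  | mem z hz =>
    obtain ⟨ϖ, u, hϖ, hu, rfl⟩ := hz
    -- `ϖ = π·u₁` with `u₁` a unit
    have hu₁ : addVal v (ϖ * π⁻¹) = 0 := by rw [addVal_mul, addVal_inv, hϖ, hπ, add_neg_cancel]
    have hϖπ : ϖ = π * (ϖ * π⁻¹) := by rw [mul_comm ϖ, ← _root_.mul_assoc, mul_inv_cancel, _root_.one_mul]
    refine ⟨symbol (Fin.cons (ϖ * π⁻¹) u : Fin (n + 1) → Eˣ), AddSubgroup.subset_closure ⟨_, fun j =>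
        Fin.cases (by rw [Fin.cons_zero]; exact hu₁) (fun k => by rw [Fin.cons_succ]; exact hu k) j, rfl⟩,
      symbol u, AddSubgroup.subset_closure ⟨u, hu, rfl⟩, ?_⟩
    conv_lhs => rw [hϖπ]
    rw [← cons_symbol, ← cons_symbol, cons_mul]
    exact _root_.add_comm _ _
  | zero => exact ⟨0, zero_mem _, 0, zero_mem _, by rw [map_zero, add_zero]⟩
  | add x y _ _ hx hy =>
    obtain ⟨a, ha, b, hb, rfl⟩ := hx
    obtain ⟨a', ha', b', hb', rfl⟩ := hy
    exact ⟨a + a', add_mem ha ha', b + b', add_mem hb hb', by rw [map_add]; abel⟩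
  | neg x _ hx =>
    obtain ⟨a, ha, b, hb, rfl⟩ := hx
    exact ⟨-a, neg_mem ha, -b, neg_mem hb, by rw [map_neg]; abel⟩

/-! ### §4 LEMMA 2.6 -/

/-- **LEMMA 2.6, EXACTNESS IN THE MIDDLE: `∂[x] = 0` in `K_nF̄/p` iff `[x]` is in the image of `s`** (write
`x = a + l(π)b` with unit symbols; `∂x = ψ b`; if `ψ b ∈ pK_nF̄` then `[b] = s(ψ b) = 0`, so `[x] = [a] = s(ψ a)`).
[cite: Milnor1970, §2 Lemma 2.6 (p0010 L18–L21) and its proof sketch (p0010 L22–L26)] -/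
theorem boundaryModP_eq_zero_iff {n : ℕ} (x : MilnorK E (n + 1)) :
    modPMap p (boundary v hπ n) (x : ModP (MilnorK E (n + 1)) p) = 0 ↔
      ∃ y : MilnorK (ValResidueField v) (n + 1), sHom v hπ p hpow (n + 1) y = (x : ModP (MilnorK E (n + 1)) p) := by
  refine ⟨fun h0 => ?_, ?_⟩
  · obtain ⟨a, ha, b, hb, rfl⟩ := exists_mem_unitSymbols_add_cons v hπ x
    have hb0 : ((psi v hπ n b : MilnorK (ValResidueField v) n) : ModP (MilnorK (ValResidueField v) n) p) = 0 := by
      rw [modPMap_mk, map_add, boundary_eq_zero_of_mem_closure_unitSymbols v hπ ha, zero_add,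
        boundary_cons_eq_psi v hπ hb] at h0
      exact h0
    -- `[b] = s(ψ b) = s(0) = 0`
    have hbE : ((b : MilnorK E n) : ModP (MilnorK E n) p) = 0 := by
      rw [← sHom_psi_eq_mk v hπ p hpow hb, ← sModP_mk, hb0, map_zero]
    obtain ⟨c, hc⟩ := (mem_pMultiples_iff _ p).1 ((QuotientAddGroup.eq_zero_iff _).1 hbE)
    refine ⟨psi v hπ (n + 1) a, ?_⟩
    rw [sHom_psi_eq_mk v hπ p hpow ha, QuotientAddGroup.mk_add, ← hc, map_zsmul, mk_zsmul_eq_zero, add_zero]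
  · rintro ⟨y, hy⟩
    rw [← hy]
    exact boundaryModP_sHom v hπ p hpow y

omit hpow in
/-- `∂ : K_{n+1}E/p → K_nF̄/p` is onto. [cite: Milnor1970, §2 Lemma 2.6 «→ K_{n−1}F/pK_{n−1}F → 0» (p0010 L18–L21); Lemma 2.1 Remarks «Evidently ∂ is always surjective» (p0005 L42)] -/
theorem boundaryModP_surjective {n : ℕ} : Function.Surjective (modPMap p (boundary v hπ n)) := by
  intro ξ
  induction ξ using QuotientAddGroup.induction_on with
  | H y =>
    obtain ⟨x, rfl⟩ := boundary_surjective v hπ (n := n) y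
    exact ⟨x, rfl⟩

/-- **LEMMA 2.6 (split exact): `[x] ↦ (ψ[x], ∂[x])` is a bijection `K_{n+1}E/p → K_{n+1}F̄/p × K_nF̄/p`** — the
clauses are `sModP_injective`, `psiModP_sModP` (`ψ ∘ s = id`), `boundaryModP_eq_zero_iff`, `boundaryModP_surjective`.
[cite: Milnor1970, §2 Lemma 2.6 «there is a natural split exact sequence 0 → K_nF/pK_nF → K_nE/pK_nE →∂ K_{n−1}F/pK_{n−1}F → 0» (p0010 L18–L21)] -/
theorem bijective_psiModP_prod_boundaryModP {n : ℕ} :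
    Function.Bijective fun ξ : ModP (MilnorK E (n + 1)) p => (modPMap p (psi v hπ (n + 1)) ξ, modPMap p (boundary v hπ n) ξ) := by
  constructor
  · intro ξ₁ ξ₂ h
    simp only [Prod.mk.injEq] at h
    obtain ⟨h1, h2⟩ := h
    induction ξ₁ using QuotientAddGroup.induction_on with
    | H x₁ =>
      induction ξ₂ using QuotientAddGroup.induction_on with
      | H x₂ =>
        have h0 : modPMap p (boundary v hπ n) ((x₁ - x₂ : MilnorK E (n + 1)) : ModP (MilnorK E (n + 1)) p) = 0 := by
          rw [QuotientAddGroup.mk_sub, map_sub, h2, sub_self]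
        obtain ⟨y, hy⟩ := (boundaryModP_eq_zero_iff v hπ p hpow _).1 h0
        have hy0 : (y : ModP (MilnorK (ValResidueField v) (n + 1)) p) = 0 := by
          rw [← psiModP_sHom v hπ p hpow y, hy, QuotientAddGroup.mk_sub, map_sub, h1, sub_self]
        have hs0 : sHom v hπ p hpow (n + 1) y = 0 := by rw [← sModP_mk, hy0, map_zero]
        rw [hs0, QuotientAddGroup.mk_sub, eq_comm, sub_eq_zero] at hy
        exact hy
  · rintro ⟨α, β⟩
    obtain ⟨ξ, hξ⟩ := boundaryModP_surjective v hπ p (n := n) β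
    refine ⟨ξ + sModP v hπ p hpow (n + 1) (α - modPMap p (psi v hπ (n + 1)) ξ), ?_⟩
    simp only [Prod.mk.injEq]
    refine ⟨by rw [map_add, psiModP_sModP, add_sub_cancel], ?_⟩
    rw [map_add, boundaryModP_sModP, add_zero, hξ]

end Lemma26

/-! ### §5 (Hₚ) for henselian valuation rings -/

section Hensel

open Polynomial

variable {E : Type*} [Field E] (v : Valuation E (WithZero (Multiplicative ℤ))) {π : Eˣ} (hπ : addVal v π = 1)

/-- **«If a unit of E maps to 1 in F̄, then it has a p-th root»** when the valuation ring is henselian (e.g. `E`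
complete) and `p ≠ char F̄`: Hensel's lemma for `X^p − u` at the simple root `1`. [cite: Milnor1970, §2 Lemma 2.6 and its proof «Suppose that a field E is complete under a discrete valuation […] for any prime p distinct from the characteristic of F̄ […] If a unit of E maps to 1 in F, then it has a p-th root» (p0010 L18–L23)] -/
theorem exists_eq_pow_of_res_eq_one [HenselianLocalRing v.valuationSubring] (p : ℕ)
    (hp : (p : ValResidueField v) ≠ 0) {u : Eˣ} (hu : addVal v u = 0) (h1 : res v hπ u = 1) :
    ∃ z : Eˣ, u = z ^ p := by
  have hp0 : p ≠ 0 := by rintro rfl; exact hp Nat.cast_zero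
  have hmem : (u : E) ∈ v.valuationSubring := WittRing.coe_mem_valuationSubring_of_addVal_eq_zero v hu
  set u₀ : v.valuationSubring := ⟨u, hmem⟩ with hu₀
  have hres1 : IsLocalRing.residue v.valuationSubring u₀ = 1 := by
    rw [hu₀, WittRing.residue_eq_coe_res v hπ hu hmem, h1, Units.val_one]
  have hmonic : (X ^ p - C u₀ : (v.valuationSubring)[X]).Monic := monic_X_pow_sub_C u₀ hp0
  have heval : (X ^ p - C u₀ : (v.valuationSubring)[X]).eval 1 ∈ IsLocalRing.maximalIdeal v.valuationSubring := by
    rw [← IsLocalRing.residue_eq_zero_iff, eval_sub, eval_pow, eval_X, eval_C, one_pow, map_sub, map_one, hres1,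
      sub_self]
  have hderiv : IsUnit ((derivative (X ^ p - C u₀ : (v.valuationSubring)[X])).eval 1) := by
    rw [derivative_sub, derivative_C, sub_zero, derivative_X_pow, eval_mul, eval_C, eval_pow, eval_X, one_pow,
      _root_.mul_one]
    refine (IsLocalRing.residue_ne_zero_iff_isUnit _).1 ?_
    rw [map_natCast]
    exact hp
  obtain ⟨a, ha, -⟩ := HenselianLocalRing.is_henselian _ hmonic 1 heval hderiv
  have hap : a ^ p = u₀ := by
    rw [IsRoot.def, eval_sub, eval_pow, eval_X, eval_C, sub_eq_zero] at ha
    exact ha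
  have haK : ((a : v.valuationSubring) : E) ^ p = (u : E) := by
    have h := congrArg (fun x : v.valuationSubring => (x : E)) hap
    simp only [SubmonoidClass.coe_pow] at h
    rw [h, hu₀]
  have ha0 : ((a : v.valuationSubring) : E) ≠ 0 := fun h => u.ne_zero (by rw [← haK, h, zero_pow hp0])
  refine ⟨Units.mk0 _ ha0, Units.ext ?_⟩
  rw [Units.val_pow_eq_pow_val, Units.val_mk0, haK]

/-- **LEMMA 2.6 for henselian `E` with `p ≠ char F̄`**: `[x] ↦ (ψ[x], ∂[x])` is a bijection
`K_{n+1}E/p → K_{n+1}F̄/p × K_nF̄/p`. [cite: Milnor1970, §2 Lemma 2.6 (p0010 L18–L21)] -/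
theorem bijective_psiModP_prod_boundaryModP_of_henselian [HenselianLocalRing v.valuationSubring] (p : ℕ)
    (hp : (p : ValResidueField v) ≠ 0) {n : ℕ} :
    Function.Bijective fun ξ : ModP (MilnorK E (n + 1)) p =>
      (modPMap p (psi v hπ (n + 1)) ξ, modPMap p (boundary v hπ n) ξ) :=
  bijective_psiModP_prod_boundaryModP v hπ p (fun _ hu h1 => exists_eq_pow_of_res_eq_one v hπ p hp hu h1)

end Hensel

end MilnorK

end Literature.RingTheory.KTheory

end
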